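import Literature.Computability.Complexity.QuadraticCongruencesNP
import Literature.Computability.Complexity.QuadraticCongruencesMachine
import Literature.Computability.Complexity.OneInThreeSubsetSumMachine
import HarnessLib

/-!
# QUADRATIC CONGRUENCES is NP-complete (Manders–Adleman 1978, Thm. 2; Garey–Johnson [AN1]): assembly

Discharge of the named fact `isNPComplete_QUADCONG : IsNPComplete QUADCONG` of
`QuadraticCongruences.lean` (Garey–Johnson, *Computers and Intractability*, §A7.1 [AN1]: "Reference:
[Manders and Adleman, 1978]. Transformation from 3SAT"), from the tree's pieces:

* `QUADCONG_mem_NP` (`QuadraticCongruencesNP.lean`: guess `x < c` and check);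
* `KNAPSACK_isNPHard` (`OneInThreeSubsetSumMachine.lean`: Cook–Levin, `SAT ≤ₚ 3SAT ≤ₚ ONEIN3SAT ≤ₚ
  KNAPSACK`, all proved in the tree) — Manders–Adleman's own route passes through "a convenient
  special case of knapsack" obtained from 3SAT; here the knapsack stage is the tree's KNAPSACK;
* `KNAPSACK_karpReducible_QUADCONG` (`QuadraticCongruencesMachine.lean`: the Manders–Adleman
  transformation `θⱼ, H, K, α = aOf, β = 2^{s+1}K, γ = H`, correct by Lemmas 1–2 of
  `MandersAdlemanLemmas.lean`, polynomial time in the brick algebra),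

propagated by `IsHard.of_reducible_holds` (Arora–Barak Thm. 2.8: hardness along `≤ₚ`).

## References

* [MandersAdleman1978] K. L. Manders, L. Adleman, *NP-complete decision problems for binary
  quadratics*, J. Comput. System Sci. 16 (1978) 168–184, §2, Thm. 2.
* [GareyJohnson1979] M. R. Garey, D. S. Johnson, *Computers and Intractability* (1979), §A7.1 [AN1].
* [AroraBarak2009] S. Arora, B. Barak, *Computational Complexity*, CUP 2009, Thm. 2.8, Def. 2.7.
-/

namespace Literature.Computability.Complexity

/-- **QUADRATIC CONGRUENCES is NP-hard**: KNAPSACK is NP-hard and `KNAPSACK ≤ₚ QUADCONG`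
(Manders–Adleman's transformation). [cite: MandersAdleman1978, §2 Thm. 2] [cite: GareyJohnson1979, §A7.1 problem AN1] -/
theorem QUADCONG_isNPHard : IsNPHard QUADCONG :=
  IsHard.of_reducible_holds KNAPSACK_isNPHard KNAPSACK_karpReducible_QUADCONG

/-- **Discharge of `isNPComplete_QUADCONG`** (Manders–Adleman 1978, Thm. 2; Garey–Johnson [AN1]):
QUADRATIC CONGRUENCES — "positive integers `a, b, c`; is there a positive `x < c` with
`x² ≡ a (mod b)`?" — is NP-complete: in `NP` by `QUADCONG_mem_NP`, NP-hard by `QUADCONG_isNPHard`.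
[cite: MandersAdleman1978, §2 Thm. 2] [cite: GareyJohnson1979, §A7.1 problem AN1] -/
theorem isNPComplete_QUADCONG_holds : isNPComplete_QUADCONG := ⟨QUADCONG_mem_NP, QUADCONG_isNPHard⟩

end Literature.Computability.Complexity
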